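import Summits.Ventures.HodgeRepro2.T5OrbitMeasure
import Summits.Ventures.HodgeRepro2.T5L2Partition
import Summits.Ventures.HodgeRepro2.T5DecompositionInvariantMeasure
import Summits.Ventures.HodgeRepro2.T5FiniteSumDecomposition

/-!
# T5OrbitL2 — `L²` of the `q`-th orbit is `L²(G_∞ ⧸ Γ_q)`, equivariantly, and `L²([G]/K_f)`
decomposes with finite multiplicities

Cell pub-hodge-repro2, seat p5, Tier 5 (route/T5-N4-p5.md, N4.3 v13 (A3) STEP 1 – STEP 2: «L^{K_f}
= ⊕_{i=1}^{h} L²(Γ_i\G_∞) as unitary G_∞-modules … hence, by STEP 1, L^{K_f} = ⊕̂_π m_{K_f}(π) H_π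
with m_{K_f}(π) := Σ_i m(π, Γ_i) < ∞»).  The last link between STEP 1 (rows 39–47, 73, 74) and
STEP 2 (rows 48–72).  Here `[G]/K_f` carries its BOREL σ-algebra (the one of a Radon measure such
as the Haar-induced one; row 45's quotient σ-algebra is removed, as rows 57–70 remove
`Quotient.instMeasurableSpace`), so that row 74's orbit embedding is a measurable embedding:

* `measurableEmbedding_embed`, `orbitMeasureB ν := comap embed ν` (finite, `A`-invariant:
  `isFiniteMeasure_orbitMeasureB`, `smulInvariantMeasure_orbitMeasureB`), `measurePreserving_embed`:
  the embedding is measure-preserving from `orbitMeasureB ν` to `ν` restricted to the orbit;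
* `res`: restriction `V_q → L²(orbit, ν|orbit)` of row 19's closed subspace `V_q ⊆ L²([G]/K_f, ν)`
  of functions supported on the orbit — a surjective linear isometry (`res_surjective_V`);
* `pull`: the pull-back `L²(orbit, ν|orbit) → L²(A ⧸ Γ_q, orbitMeasure ν)` along the embedding — a
  surjective linear isometry (`pull_surjective`, by `MeasurableEmbedding.exists_measurable_extend`);
* **`Ψ : V_q ≃ₗᵢ[ℂ] L²(A ⧸ Γ_q, orbitMeasureB ν)`** and **`intertwines_Ψ`**: `Ψ` intertwines the
  restriction of the regular representation of `A` on `L²([G]/K_f, ν)` to `V_q` with the regular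
  representation of `A` on `L²(A ⧸ Γ_q, orbitMeasureB ν)` — STEP 1's «as unitary G_∞-modules»;
* **`hasDecomposition_restrict_V`**: the restriction of the regular representation to `V_q` has a
  decomposition with finite multiplicities ([DE] Thm 9.2.2 on `A ⧸ Γ_q` for the invariant measure
  `orbitMeasureB ν`, row 70, transported along `Ψ` by row 60; trivially if `ν` does not charge the
  orbit);
* **`hasDecomposition_regularRep`**: **`L²([G]/K_f, ν)` with the regular representation of
  `A = G_∞` is the closed orthogonal sum of irreducible closed `A`-stable subspaces with every
  unitary-equivalence class FINITE** — the finite orthogonal sum over the orbits (row 19's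
  partition of `L²` along p2's partition of `[G]/K_f`, row 72) — for `H` discrete in `A × B`, `K`
  compact open, `[G]/K_f` compact, `A` locally compact second countable Hausdorff, and ANY
  `A`-invariant finite Borel measure `ν` on `[G]/K_f`: STEP 1 + STEP 2 of (A3) in kernel on the
  abstract model, «m_{K_f}(π) = Σ_i m(π, Γ_i) < ∞».

Imports rows 19 / 36 / 39 / 40 / 60 / 70 / 72 / 73 / 74 (and p2's `T5DoubleCosetDecomposition`)
and Mathlib.  Axioms: propext, Classical.choice, Quot.sound.
README §8(d): uses an L-value-free non-vanishing device: NO.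
-/

namespace Summit.Ventures.HodgeRepro2.T5OrbitL2

open MeasureTheory Set Topology Filter
open scoped NNReal Pointwise InnerProductSpace
open Summit.Ventures.HodgeRepro2.T5DoubleCosetDecomposition
open Summit.Ventures.HodgeRepro2.T5DoubleCosetTopology
open Summit.Ventures.HodgeRepro2.T5OrbitHomeomorph
open Summit.Ventures.HodgeRepro2.T5OrbitMeasure
open Summit.Ventures.HodgeRepro2.T5L2Partition
open Summit.Ventures.HodgeRepro2.T5RegularRep (regularRep coeFn_regularRep_apply)
open Summit.Ventures.HodgeRepro2.T5ComponentHilbertSum (preimage_smul_range_toFull)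
open Summit.Ventures.HodgeRepro2.T5DecompositionTransport (IntertwinesRep
  exists_decomposition_of_intertwines)
open Summit.Ventures.HodgeRepro2.T5FiniteSumDecomposition (HasDecomposition
  hasDecomposition_of_finite_sum)
open Summit.Ventures.HodgeRepro2.T5CompleteReducibility (IsStable)
open Summit.Ventures.HodgeRepro2.T5RestrictionRep (restrictRep coe_restrictRep_apply)

attribute [-instance] Summit.Ventures.HodgeRepro2.T5RightCosetAction.instMeasurableSpaceDoubleCoset
attribute [-instance] Quotient.instMeasurableSpace

variable {A B : Type*} [Group A] [Group B] (H : Subgroup (A × B)) (K : Subgroup B)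
  [TopologicalSpace A] [TopologicalSpace B] [IsTopologicalGroup A] [IsTopologicalGroup B]
  [MeasurableSpace (FullQuotient H K)] [BorelSpace (FullQuotient H K)]
  (hK : IsOpen (K : Set B)) (q : FiniteQuotient H K)
  [MeasurableSpace (A ⧸ gammaGroup H K (rep q))] [BorelSpace (A ⧸ gammaGroup H K (rep q))]
  (ν : Measure (FullQuotient H K))

/-! ### The orbit embedding as a measurable embedding (Borel σ-algebras) -/

include hK in
omit [MeasurableSpace (A ⧸ gammaGroup H K (rep q))]
  [BorelSpace (A ⧸ gammaGroup H K (rep q))] in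
/-- The orbit is measurable (it is open). -/
theorem measurableSet_orbit : MeasurableSet (Set.range (toFull q)) :=
  (isOpen_range_toFull H K hK q).measurableSet

include hK in
omit [BorelSpace (FullQuotient H K)]
  [MeasurableSpace (A ⧸ gammaGroup H K (rep q))] [BorelSpace (A ⧸ gammaGroup H K (rep q))] in
/-- **`V_q ⊆ L²([G]/K_f, ν)`**: the closed subspace of classes vanishing off the `q`-th orbit
(row 19's `V`). -/
noncomputable abbrev Vq : Submodule ℂ (Lp ℂ 2 ν) :=
  V (μ := ν) (𝕜 := ℂ) (E := ℂ) (measurableSet_orbit H K hK q)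

/-- `embed` is a measurable embedding (an open embedding between Borel spaces). -/
theorem measurableEmbedding_embed : MeasurableEmbedding (embed H K hK q) :=
  (isOpenEmbedding_embed H K hK q).measurableEmbedding

/-- `embed` is measurable. -/
theorem measurable_embed : Measurable (embed H K hK q) :=
  (measurableEmbedding_embed H K hK q).measurable

/-- **The measure induced on the `q`-th orbit** (Borel version of row 74's `orbitMeasure`):
`orbitMeasureB ν S = ν (embed '' S)`. -/
noncomputable def orbitMeasureB : Measure (A ⧸ gammaGroup H K (rep q)) :=
  Measure.comap (embed H K hK q) ν

/-- `orbitMeasureB` on sets. -/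
theorem orbitMeasureB_apply (S : Set (A ⧸ gammaGroup H K (rep q))) :
    orbitMeasureB H K hK q ν S = ν (embed H K hK q '' S) :=
  (measurableEmbedding_embed H K hK q).comap_apply ν S

/-- The induced measure is finite for `ν` finite. -/
theorem isFiniteMeasure_orbitMeasureB [IsFiniteMeasure ν] :
    IsFiniteMeasure (orbitMeasureB H K hK q ν) :=
  ⟨by rw [orbitMeasureB_apply]; exact measure_lt_top _ _⟩

/-- The induced measure is `A`-invariant for `ν` invariant (row 74's `image_embed_preimage_smul`). -/
theorem smulInvariantMeasure_orbitMeasureB [SMulInvariantMeasure A (FullQuotient H K) ν] :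
    SMulInvariantMeasure A (A ⧸ gammaGroup H K (rep q)) (orbitMeasureB H K hK q ν) := by
  refine ⟨fun a S hS => ?_⟩
  rw [orbitMeasureB_apply, orbitMeasureB_apply, T5OrbitMeasure.image_embed_preimage_smul,
    SMulInvariantMeasure.measure_preimage_smul a
      ((measurableEmbedding_embed H K hK q).measurableSet_image.2 hS)]

omit [MeasurableSpace (FullQuotient H K)]
  [BorelSpace (FullQuotient H K)] [MeasurableSpace (A ⧸ gammaGroup H K (rep q))]
  [BorelSpace (A ⧸ gammaGroup H K (rep q))] in
/-- The range of `embed` is the orbit. -/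
theorem range_embed : Set.range (embed H K hK q) = Set.range (toFull q) := by
  ext t
  constructor
  · rintro ⟨y, rfl⟩
    exact (orbitHomeomorph H K hK q y).2
  · intro ht
    exact ⟨(orbitHomeomorph H K hK q).symm ⟨t, ht⟩, by simp [embed]⟩

/-- `embed` is measure-preserving from `orbitMeasureB ν` to `ν` restricted to the orbit. -/
theorem measurePreserving_embed :
    MeasurePreserving (embed H K hK q) (orbitMeasureB H K hK q ν)
      (ν.restrict (Set.range (toFull q))) :=
  ⟨measurable_embed H K hK q, by
    simp only [orbitMeasureB]
    rw [(measurableEmbedding_embed H K hK q).map_comap, range_embed]⟩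

/-! ### Restriction to the orbit: `V_q → L²(orbit, ν|orbit)` -/

/-- The restriction of an `L²`-class to the orbit. -/
noncomputable def resFun (f : Lp ℂ 2 ν) : Lp ℂ 2 (ν.restrict (Set.range (toFull q))) :=
  MemLp.toLp (f : FullQuotient H K → ℂ) ((Lp.memLp f).restrict _)

omit [TopologicalSpace A] [TopologicalSpace B] [IsTopologicalGroup A] [IsTopologicalGroup B]
  [BorelSpace (FullQuotient H K)]
  [MeasurableSpace (A ⧸ gammaGroup H K (rep q))] [BorelSpace (A ⧸ gammaGroup H K (rep q))] in
/-- `resFun` on functions. -/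
theorem coeFn_resFun (f : Lp ℂ 2 ν) :
    (resFun H K q ν f : FullQuotient H K → ℂ) =ᵐ[ν.restrict (Set.range (toFull q))] f :=
  MemLp.coeFn_toLp _

omit [TopologicalSpace A] [TopologicalSpace B] [IsTopologicalGroup A] [IsTopologicalGroup B]
  [BorelSpace (FullQuotient H K)]
  [MeasurableSpace (A ⧸ gammaGroup H K (rep q))] [BorelSpace (A ⧸ gammaGroup H K (rep q))] in
/-- `resFun` is additive. -/
theorem resFun_add (f g : Lp ℂ 2 ν) : resFun H K q ν (f + g) = resFun H K q ν f + resFun H K q ν g := by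
  unfold resFun
  rw [← MemLp.toLp_add]
  exact MemLp.toLp_congr _ _ (ae_restrict_of_ae (Lp.coeFn_add f g))

omit [TopologicalSpace A] [TopologicalSpace B] [IsTopologicalGroup A] [IsTopologicalGroup B]
  [BorelSpace (FullQuotient H K)]
  [MeasurableSpace (A ⧸ gammaGroup H K (rep q))] [BorelSpace (A ⧸ gammaGroup H K (rep q))] in
/-- `resFun` commutes with scalars. -/
theorem resFun_smul (c : ℂ) (f : Lp ℂ 2 ν) : resFun H K q ν (c • f) = c • resFun H K q ν f := by
  unfold resFun
  rw [← MemLp.toLp_const_smul]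
  exact MemLp.toLp_congr _ _ (ae_restrict_of_ae (Lp.coeFn_smul c f))

omit [MeasurableSpace (A ⧸ gammaGroup H K (rep q))]
  [BorelSpace (A ⧸ gammaGroup H K (rep q))] in
/-- On `V_q`, `resFun` preserves the norm (row 19's `norm_restrictL`). -/
theorem norm_resFun_of_mem {f : Lp ℂ 2 ν} (hf : f ∈ Vq H K hK q ν) :
    ‖resFun H K q ν f‖ = ‖f‖ := by
  rw [resFun, Lp.norm_toLp, ← norm_restrictL (𝕜 := ℂ) (measurableSet_orbit H K hK q) f,
    (mem_V_iff (𝕜 := ℂ) _ f).1 hf]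

/-- **The restriction isometry** `V_q →ₗᵢ L²(orbit, ν|orbit)`. -/
noncomputable def res :
    Vq H K hK q ν →ₗᵢ[ℂ] Lp ℂ 2 (ν.restrict (Set.range (toFull q))) where
  toFun f := resFun H K q ν f
  map_add' f g := by rw [Submodule.coe_add, resFun_add]
  map_smul' c f := by rw [Submodule.coe_smul, resFun_smul]; rfl
  norm_map' f := norm_resFun_of_mem H K hK q ν f.2

omit [MeasurableSpace (A ⧸ gammaGroup H K (rep q))] [BorelSpace (A ⧸ gammaGroup H K (rep q))] in
/-- `res` on vectors. -/
theorem res_apply (f : Vq H K hK q ν) :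
    res H K hK q ν f = resFun H K q ν f :=
  rfl

omit [MeasurableSpace (A ⧸ gammaGroup H K (rep q))] [BorelSpace (A ⧸ gammaGroup H K (rep q))] in
/-- **`res` is surjective**: `g ∈ L²(orbit, ν|orbit)` is the restriction of `1_orbit · g ∈ V_q`. -/
theorem res_surjective_V : Function.Surjective (res H K hK q ν) := by
  intro g
  have hs := measurableSet_orbit H K hK q
  have hmem : MemLp ((Set.range (toFull q)).indicator (g : FullQuotient H K → ℂ)) 2 ν :=
    (memLp_indicator_iff_restrict hs).2 (Lp.memLp g)
  refine ⟨⟨MemLp.toLp _ hmem, ?_⟩, ?_⟩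
  · rw [mem_V_iff_ae]
    filter_upwards [MemLp.coeFn_toLp hmem] with x hx hxs
    rw [hx, Set.indicator_of_notMem hxs]
  · rw [res_apply]
    unfold resFun
    conv_rhs => rw [← Lp.toLp_coeFn g (Lp.memLp g)]
    refine MemLp.toLp_congr _ _ ?_
    have h1 : ((MemLp.toLp _ hmem : Lp ℂ 2 ν) : FullQuotient H K → ℂ) =ᵐ[ν.restrict (Set.range (toFull q))]
        (Set.range (toFull q)).indicator (g : FullQuotient H K → ℂ) :=
      ae_restrict_of_ae (MemLp.coeFn_toLp hmem)
    have h2 : (Set.range (toFull q)).indicator (g : FullQuotient H K → ℂ) =ᵐ[ν.restrict (Set.range (toFull q))]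
        (g : FullQuotient H K → ℂ) := by
      filter_upwards [ae_restrict_mem hs] with x hx
      exact Set.indicator_of_mem hx _
    exact h1.trans h2

/-! ### Pull-back along the embedding: `L²(orbit, ν|orbit) → L²(A ⧸ Γ_q, orbitMeasure ν)` -/

/-- **The pull-back isometry** along `embed`. -/
noncomputable def pull :
    Lp ℂ 2 (ν.restrict (Set.range (toFull q))) →ₗᵢ[ℂ] Lp ℂ 2 (orbitMeasureB H K hK q ν) :=
  Lp.compMeasurePreservingₗᵢ ℂ (embed H K hK q) (measurePreserving_embed H K hK q ν)

/-- `pull` on functions. -/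
theorem coeFn_pull (g : Lp ℂ 2 (ν.restrict (Set.range (toFull q)))) :
    (pull H K hK q ν g : A ⧸ gammaGroup H K (rep q) → ℂ) =ᵐ[orbitMeasureB H K hK q ν]
      (g : FullQuotient H K → ℂ) ∘ embed H K hK q :=
  Lp.coeFn_compMeasurePreserving g _

/-- **`pull` is surjective**: every class on `A ⧸ Γ_q` extends along the measurable embedding. -/
theorem pull_surjective : Function.Surjective (pull H K hK q ν) := by
  intro g
  have hg := Lp.memLp g
  set g₀ : A ⧸ gammaGroup H K (rep q) → ℂ := hg.1.mk (g : A ⧸ gammaGroup H K (rep q) → ℂ) with hg₀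
  have hg₀m : Measurable g₀ := hg.1.stronglyMeasurable_mk.measurable
  have hg₀e : (g : A ⧸ gammaGroup H K (rep q) → ℂ) =ᵐ[orbitMeasureB H K hK q ν] g₀ := hg.1.ae_eq_mk
  obtain ⟨g', hg'm, hg'⟩ :=
    (measurableEmbedding_embed H K hK q).exists_measurable_extend hg₀m fun _ => ⟨(0 : ℂ)⟩
  have hg'L : MemLp g' 2 (ν.restrict (Set.range (toFull q))) := by
    refine ⟨hg'm.aestronglyMeasurable, ?_⟩
    rw [← (measurePreserving_embed H K hK q ν).map_eq,
      (measurableEmbedding_embed H K hK q).eLpNorm_map_measure, hg']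
    exact (hg.ae_eq hg₀e).2
  refine ⟨MemLp.toLp g' hg'L, Lp.ext ?_⟩
  calc (pull H K hK q ν (MemLp.toLp g' hg'L) : A ⧸ gammaGroup H K (rep q) → ℂ)
      =ᵐ[orbitMeasureB H K hK q ν] ((MemLp.toLp g' hg'L : Lp ℂ 2 _) : FullQuotient H K → ℂ) ∘
          embed H K hK q := coeFn_pull H K hK q ν _
    _ =ᵐ[orbitMeasureB H K hK q ν] g' ∘ embed H K hK q :=
        (measurePreserving_embed H K hK q ν).quasiMeasurePreserving.ae_eq_comp
          (MemLp.coeFn_toLp hg'L)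
    _ = g₀ := hg'
    _ =ᵐ[orbitMeasureB H K hK q ν] (g : A ⧸ gammaGroup H K (rep q) → ℂ) := hg₀e.symm

/-! ### The unitary identification and its equivariance -/

/-- **`Ψ : V_q ≃ₗᵢ L²(A ⧸ Γ_q, orbitMeasure ν)`** — restriction to the orbit followed by the
pull-back along the embedding. -/
noncomputable def Ψ :
    Vq H K hK q ν ≃ₗᵢ[ℂ] Lp ℂ 2 (orbitMeasureB H K hK q ν) :=
  LinearIsometryEquiv.ofSurjective ((pull H K hK q ν).comp (res H K hK q ν))
    ((pull_surjective H K hK q ν).comp (res_surjective_V H K hK q ν))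

/-- `Ψ` on functions: `Ψ f = f ∘ embed` almost everywhere. -/
theorem coeFn_Ψ (f : Vq H K hK q ν) :
    (Ψ H K hK q ν f : A ⧸ gammaGroup H K (rep q) → ℂ) =ᵐ[orbitMeasureB H K hK q ν]
      ((f : Lp ℂ 2 ν) : FullQuotient H K → ℂ) ∘ embed H K hK q := by
  refine (coeFn_pull H K hK q ν (res H K hK q ν f)).trans ?_
  exact (measurePreserving_embed H K hK q ν).quasiMeasurePreserving.ae_eq_comp
    (coeFn_resFun H K q ν f)

omit [MeasurableSpace (A ⧸ gammaGroup H K (rep q))]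
  [BorelSpace (A ⧸ gammaGroup H K (rep q))] in
/-- `V_q` is stable under the regular representation of `A` (the orbit is `A`-stable; row 19's
`compMeasurePreserving_mem_V`). -/
theorem isStable_V [SMulInvariantMeasure A (FullQuotient H K) ν] :
    IsStable (regularRep (G := A) ν) (Vq H K hK q ν) := fun a _ hf => by
  rw [T5RegularRep.regularRep_apply]
  exact compMeasurePreserving_mem_V _ _ (preimage_smul_range_toFull H K a⁻¹ q) hf

/-- **`Ψ` intertwines** the restriction of the regular representation of `A` on `L²([G]/K_f, ν)` to
`V_q` with the regular representation of `A` on `L²(A ⧸ Γ_q, orbitMeasure ν)`. -/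
theorem intertwines_Ψ [SMulInvariantMeasure A (FullQuotient H K) ν] :
    haveI := smulInvariantMeasure_orbitMeasureB H K hK q ν
    IntertwinesRep (restrictRep (regularRep (G := A) ν) _ (isStable_V H K hK q ν))
      (regularRep (G := A) (orbitMeasureB H K hK q ν)) (Ψ H K hK q ν) := by
  haveI := smulInvariantMeasure_orbitMeasureB H K hK q ν
  intro a f
  refine Lp.ext ?_
  have h1 : (Ψ H K hK q ν (restrictRep (regularRep (G := A) ν) _ (isStable_V H K hK q ν) a f) :
      A ⧸ gammaGroup H K (rep q) → ℂ) =ᵐ[orbitMeasureB H K hK q ν]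
      ((regularRep (G := A) ν a (f : Lp ℂ 2 ν) : Lp ℂ 2 ν) : FullQuotient H K → ℂ) ∘
        embed H K hK q :=
    coeFn_Ψ H K hK q ν _
  have h2 : ((regularRep (G := A) ν a (f : Lp ℂ 2 ν) : Lp ℂ 2 ν) : FullQuotient H K → ℂ) ∘
      embed H K hK q =ᵐ[orbitMeasureB H K hK q ν]
      (((f : Lp ℂ 2 ν) : FullQuotient H K → ℂ) ∘ fun t => a⁻¹ • t) ∘ embed H K hK q :=
    (measurePreserving_embed H K hK q ν).quasiMeasurePreserving.ae_eq_comp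
      (ae_restrict_of_ae (coeFn_regularRep_apply ν a (f : Lp ℂ 2 ν)))
  have h3 : (((f : Lp ℂ 2 ν) : FullQuotient H K → ℂ) ∘ fun t => a⁻¹ • t) ∘ embed H K hK q =
      (((f : Lp ℂ 2 ν) : FullQuotient H K → ℂ) ∘ embed H K hK q) ∘ fun y => a⁻¹ • y := by
    ext y
    simp only [Function.comp_apply, embed_smul]
  have h4 : (regularRep (G := A) (orbitMeasureB H K hK q ν) a (Ψ H K hK q ν f) :
      A ⧸ gammaGroup H K (rep q) → ℂ) =ᵐ[orbitMeasureB H K hK q ν]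
      (Ψ H K hK q ν f : A ⧸ gammaGroup H K (rep q) → ℂ) ∘ fun y => a⁻¹ • y :=
    coeFn_regularRep_apply _ a _
  have h5 : (Ψ H K hK q ν f : A ⧸ gammaGroup H K (rep q) → ℂ) ∘ (fun y => a⁻¹ • y)
      =ᵐ[orbitMeasureB H K hK q ν]
      (((f : Lp ℂ 2 ν) : FullQuotient H K → ℂ) ∘ embed H K hK q) ∘ fun y => a⁻¹ • y :=
    (measurePreserving_smul a⁻¹ (orbitMeasureB H K hK q ν)).quasiMeasurePreserving.ae_eq_comp
      (coeFn_Ψ H K hK q ν f)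
  calc (Ψ H K hK q ν (restrictRep (regularRep (G := A) ν) _ (isStable_V H K hK q ν) a f) :
        A ⧸ gammaGroup H K (rep q) → ℂ)
      =ᵐ[orbitMeasureB H K hK q ν] _ := h1
    _ =ᵐ[orbitMeasureB H K hK q ν] _ := h2
    _ = _ := h3
    _ =ᵐ[orbitMeasureB H K hK q ν] _ := h5.symm
    _ =ᵐ[orbitMeasureB H K hK q ν] _ := h4.symm

/-! ### The decomposition on every orbit, and the finite sum -/

/-- **The restriction of the regular representation to `V_q` has a decomposition with finite
multiplicities** ([DE] Thm 9.2.2 on `A ⧸ Γ_q` for the invariant measure `orbitMeasure ν`, row 70,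
transported along `Ψ`; trivial when `ν` does not charge the orbit). -/
theorem hasDecomposition_restrict_V [MeasurableSpace A] [BorelSpace A] [T2Space A]
    [LocallyCompactSpace A]
    [SecondCountableTopology A] [T2Space B] [DiscreteTopology H] (hKc : IsCompact (K : Set B))
    [CompactSpace (FullQuotient H K)] [IsFiniteMeasure ν]
    [SMulInvariantMeasure A (FullQuotient H K) ν] :
    HasDecomposition (restrictRep (regularRep (G := A) ν) _ (isStable_V H K hK q ν)) := by
  haveI := T5CocompactInversion.discreteTopology_gammaGroup H K hKc (rep q)
  haveI := T5CocompactInversion.compactSpace_quotient_gammaGroup H K hK q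
  haveI := isFiniteMeasure_orbitMeasureB H K hK q ν
  haveI := smulInvariantMeasure_orbitMeasureB H K hK q ν
  by_cases h0 : orbitMeasureB H K hK q ν = 0
  · -- `ν` does not charge the orbit: `V_q = 0`
    have hae : ae (orbitMeasureB H K hK q ν) = ⊥ := by rw [h0]; exact ae_zero
    have hzero : ∀ g : Lp ℂ 2 (orbitMeasureB H K hK q ν), g = 0 := fun g =>
      Lp.eq_zero_iff_ae_eq_zero.2 (by rw [Filter.EventuallyEq, hae]; exact Filter.eventually_bot)
    haveI : Subsingleton (Vq H K hK q ν) :=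
      ⟨fun f g => (Ψ H K hK q ν).injective ((hzero _).trans (hzero _).symm)⟩
    exact ⟨∅, fun _ h => absurd h (Set.notMem_empty _), Set.pairwise_empty _,
      Subsingleton.elim _ _, fun _ h => absurd h (Set.notMem_empty _)⟩
  · obtain ⟨S, hS⟩ := T5DecompositionInvariantMeasure.exists_decomposition_of_invariant
      (Γ := gammaGroup H K (rep q)) (orbitMeasureB H K hK q ν) h0
    exact exists_decomposition_of_intertwines (intertwines_Ψ H K hK q ν) ⟨S, hS⟩

include hK in
/-- **STEP 1 + STEP 2 of (A3) on the abstract model**: for `H` discrete in `A × B`, `K` compact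
open, `[G]/K_f` compact, `A = G_∞` locally compact second countable Hausdorff, and ANY `A`-invariant
finite measure `ν` on `[G]/K_f`, `L²([G]/K_f, ν)` with the regular representation of `A` is the
closed orthogonal sum of irreducible closed `A`-stable subspaces, every unitary-equivalence class
of which is FINITE — «L^{K_f} = ⊕̂_π m_{K_f}(π) H_π with m_{K_f}(π) = Σ_i m(π, Γ_i) < ∞». -/
theorem hasDecomposition_regularRep [MeasurableSpace A] [BorelSpace A] [T2Space A]
    [LocallyCompactSpace A]
    [SecondCountableTopology A] [T2Space B] [DiscreteTopology H] (hKc : IsCompact (K : Set B))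
    [CompactSpace (FullQuotient H K)]
    [∀ q : FiniteQuotient H K, MeasurableSpace (A ⧸ gammaGroup H K (rep q))]
    [∀ q : FiniteQuotient H K, BorelSpace (A ⧸ gammaGroup H K (rep q))]
    [IsFiniteMeasure ν] [SMulInvariantMeasure A (FullQuotient H K) ν] :
    HasDecomposition (regularRep (G := A) ν) := by
  haveI : Finite (FiniteQuotient H K) := finite_finiteQuotient H K hK
  haveI : Fintype (FiniteQuotient H K) := Fintype.ofFinite _
  refine hasDecomposition_of_finite_sum (fun q => Vq H K hK q ν)
    (fun q => isClosed_V _) (fun q => isStable_V H K hK q ν) ?_ ?_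
    (fun q => hasDecomposition_restrict_V H K hK q ν hKc)
  · intro q q' hne
    exact V_isOrtho _ _ (pairwise_disjoint_range_toFull hne)
  · rw [iSup_V_eq_top (fun q => measurableSet_orbit H K hK q) pairwise_disjoint_range_toFull
      iUnion_range_toFull]
    exact le_antisymm le_top (Submodule.le_topologicalClosure ⊤)

end Summit.Ventures.HodgeRepro2.T5OrbitL2
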